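import Summits.Ventures.HodgeRepro2.T6N3Interface
import Summits.Ventures.HodgeRepro2.T6N3Hyp

/-!
# T6N3Bridge — the dictionaries from the N3 displays to the N3 interface Props (declared residuals)

Cell pub-hodge-repro2, Tier 6 (README §10), seat t6-p3 (N3 owner, M2). Definition lane; `def … : Prop`
only; NOT displays (no printed statement is quoted). Each Prop is an implication «displayed printed
theorem(s) ⟹ interface Prop of the datum» — the [A]-class dictionary of the record by which the printed
input enters Proposition N* (TIER5 §N3.3 rows T2 / T4, N3.L5, N3.7(a)–(b)). They are BINDERS of the N3
mains (`T6N3Main.lean`), so that the displays of `T6N3Hyp.lean` are consumed BY NAME and the residual is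
exactly the dictionary, declared with its class on the M2 line (TARGET-T6 §9.5, class AD).

§8(d): uses an L-value-free non-vanishing device: NO.
-/

namespace Summit.Ventures.HodgeRepro2.T6.N3Datum

variable (𝒟 : N3Datum)

/-- [residual: AD; the dictionary of row T4 — «`m(σ) ≤ 1` for every irreducible automorphic `σ` of `U(V)`»
(from Rogawski's Theorems 14.6.4 / 14.6.5 and the Π_s case, `RogawskiPackets.MultLeOne`) ⟹ the τ-parts of
distinct τ-type automorphic subrepresentations of `L²([G])` admit no non-zero `G(𝔸_f)`-equivariant map
(N3.L8 (1): «`σ′_f ≅ σ″_f` with the same `σ′_∞ = σ″_∞` would make `σ′ ≅ σ″` abstractly, hence `σ′ = σ″` as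
subspaces by `m ≤ 1`», + Schur's lemma); what print would discharge it: the identification of the packet
carrier's discrete spectrum of `G′ = U(V)` with the automorphic subrepresentations of the datum, and the
one-dimensionality of the τ-isotypic part of the (2,0)-cohomological archimedean module (row T7)] -/
def RogawskiBridge (R : RogawskiPackets) (hst : 𝒟.AutStable) : Prop :=
  R.MultLeOne → 𝒟.AutNonIso hst

/-- [residual: AD; the dictionary of row T2 / N3.L5 — local Howe duality (HD) at every place
(`Hyp.GanTakeda2016_Thm1_2` on the local shapes `L v` at the non-archimedean places with `E_v` a field;
Mínguez at the split places and Howe 1989 at the archimedean places are not displayed here and are part of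
the residual) ⟹ the isotypic confinement of the theta lift of one side: `K_ψ ∈ Π(π₀)` for `ψ ∈ σ` and `Θ(f, φ)
∈ σ` for `f ∈ Π(π₀)` (N3.L5(b)/(c), through restricted tensor products and the Casselman–Wallach
globalisation at the real places — N3.7(b)); what print would discharge it: the primaries Howe 1989 / Mínguez
2008 for the other places and a printed form of the restricted-tensor-product argument] -/
def HoweDualityBridge {ι : Type} (L : ι → HoweDualityShape) (X : N3Side 𝒟.LG 𝒟.Gf) : Prop :=
  (∀ v, Hyp.GanTakeda2016_Thm1_2 (L v)) → X.KliftIsotypic ∧ X.ThetaMemSigma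

end Summit.Ventures.HodgeRepro2.T6.N3Datum
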